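/-
Copyright (c) 2026 the pub-hodgecm-mathlib formalisation cell (harness21).  Prover seat hodgecm-mathlib-F0P3a-p08 (g19): «S3-ram» seeding wave (LEAD F0P3a-plan (g12), owner
F0P3a-p06 (g15)), row (e2)(b) «[T2-c]-ram» (holder A-p19 (g26), PLAN-T2c-ram-layer3), LAYER 3 brick (ii-e) «NORM INDICES» — co-hand deal 2026-09-01T22:13:38Z.
-/
import Literature.NumberTheory.LocalFields.RamifiedQuadraticNormCriterion   -- ★ B-p10: `exists_fixed_isUnit_not_exists_mul_map_eq`, `exists_mul_map_eq_or_eq_mul`, `isSquare_residue_of_mul_map_eq`, `exists_mul_map_eq_of_isSquare_residue`; brings ★ `UnramifiedQuadraticNorm.exists_mul_map_eq_of_finite_residueField`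
import Mathlib.GroupTheory.Index
import Mathlib.Algebra.Group.Submonoid.Units
import HarnessLib

/-!
# Norm indices of fixed units for a product of two local rings with involutions over a TAMELY RAMIFIED base: `[G : W] = 4` (type A) ∕ `2` (type B), `[H : H ∩ W] = 2`
# (Serre, *Local Fields*, Ch. V §2 Prop. 3, §3 Cor. 2 of Prop. 5)

Topic `NumberTheory/LocalFields`; namespace `Literature.NumberTheory.LocalFields.RamifiedQuadraticNorm` (sequel of ★ B-p10 `RamifiedQuadraticNormCriterion`).  THEOREMS ONLY
(no definition, no instance, no notation, no named fact, no `sorry`); σ-INTRINSIC (abstract commutative rings with ring involutions; local ∕ complete ∕ finite-residue-field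
hypotheses as instance arguments, exactly as in ★ B-p10).  Cell `pub/hodgecm-mathlib` (D-0151), crux H413 = `stmt-HodgeConjecture-24833`; «S3-ram» seeding wave, row (e2)(b)
«[T2-c]-ram» = the unit index `[C : R^×]` of the type-(2) order `R = 𝒪_E[(u, λ)] ≤ Λ = 𝒪_E × 𝒪_M` at a TAME-RAMIFIED base `E ∕ F` (`σΠ = −Π`) with UNRAMIFIED eigen-field
`M = E(√ε)` (A-p19 (g26): layers 1–2 ★ p846900 ∕ p846912, defective descent ★ p846932, CERT «[T2-c]-ram» 22:10Z: `[C : R^×] = 2·q^{(N+n−1)∕2}` (type A) ∕ `(q+1)·q^{(N+n−2)∕2}`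
(type B)).  THIS FILE = PLAN-T2c-ram-layer3 brick **(ii-e)**: the two NORM INDICES entering ★ C2a `relIndex_comap_norm_mul_relIndex_eq_index` (`[C : V]·[W : V ∩ W] = [Λ^× : V]`,
`V = R^×`, `W = N(Λ^×)`, `N = id·⋆`) through the index identity of §4.
HONEST LABEL: HC_CM is proved only modulo the 2 remaining named inputs (hLiu418 24832, h413 24833) until rung 0 closes; unconditional commutative algebra, count-neutral.

SETTING.  `Λ = A × B` with `⋆ = (s, t)` (`RingHom.prodMap s t`), `s` an involution of `A` of RAMIFIED TYPE (residually trivial: `s x − x ∈ 𝔪_A`; `2 ∈ Aˣ`; `A` local, `𝔪`-adically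
complete, finite residue field — so `A`'s `s`-fixed units are norms `x·s x` exactly when their residue is a square, INDEX TWO, ★ B-p10), and `t` an involution of `B` of
either RAMIFIED TYPE («type A»: `M ∕ K′` ramified, `σ̃θ = θ`) or UNRAMIFIED TYPE (`t b₀ − b₀ ∈ Bˣ` for some `b₀`; «type B»: `σ̃θ = −θ`, `M ∕ K′` unramified — then EVERY `t`-fixed unit is
a norm, ★ `UnramifiedQuadraticNorm.exists_mul_map_eq_of_finite_residueField`).  Spellings VERBATIM ★ C2a p846524: fixed units `G := (RingHom.eqLocus ⋆ (RingHom.id Λ)).toSubmonoid.units`,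
norms `W := (MonoidHom.id Λˣ * Units.map ⋆).range`.

* §1 (any `Λ`, `⋆`): `mem_units_eqLocus_iff` (`g ∈ G ↔ ⋆g = g`), `mem_range_norm_iff` (`g ∈ W ↔ ∃ z, z·⋆z = g`), `mem_range_norm_prodMap_iff` (coordinatewise), `mul_map_mul_mul_map`
  (product of norms), `fixed_mul_norm` (`η·(η·z⋆z) = (ηz)·⋆(ηz)` for fixed `η`).
* §2 THE SUBGROUP DICHOTOMY **`relIndex_range_norm_eq_two_of_snd_norm`**: for `H ≤ G` containing some `η₀` whose FIRST coordinate has NON-square residue, and all of whose elements have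
  a `t`-NORM second coordinate, `W.relIndex H = 2` — i.e. `[H : H ∩ W] = 2` (Mathlib `Subgroup.relIndex_eq_two_iff_exists_notMem_and'` over ★ B-p10's dichotomy on `A`).
  Corollaries `…_of_unramified` (type B: the second-coordinate clause is automatic) and `…_of_isSquare_residue` (type A: from square residues in `B`).  In (iii) `H = R^{⋆×}`.
* §3 THE FULL FIXED UNITS: **`relIndex_range_norm_units_eqLocus_eq_two`** (type B: `[G : W] = 2`, witness `(η, 1)`) and **`relIndex_range_norm_units_eqLocus_eq_four`** (type A:
  `[G : W] = 4` through the chain `W ≤ W′ ≤ G`, `W′ = G ⊓ {second coordinate a t-norm}` spelled as a `comap`, two dichotomies with witnesses `(η_A, 1)` and `(1, η_B)`).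
* §4 `relIndex_mul_relIndex_eq_relIndex_inf_mul` — the index identity `[W : V∩W]·[G : W] = [V⊓G : V∩W]·[G : V⊓G]` (`W ≤ G`, any group) by which (iii) converts §2–§3 and (ii-d)
  `[G : V ⊓ G]` into `[W : V ∩ W]`.

## References
* [Serre1979] J.-P. Serre, *Local Fields*, GTM 67 (1979): Ch. V §2 Prop. 3 and Corollary (unramified: `U_K = N U_L`), Ch. V §3 Prop. 5 and Cor. 2 p. 86 (totally tamely ramified,
  `ℓ = 2`: `U_K ∕ N U_L ≅ K̄ˣ ∕ K̄ˣ²` of order `2`).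
* [Hungerford1974] T. W. Hungerford, *Algebra*, GTM 73 (1974): Ch. I Thm. 4.5 (index multiplicativity).
* [Neukirch1999] J. Neukirch, *Algebraic Number Theory*, Grundlehren 322 (1999): Ch. I §12 (orders and unit indices).
-/

set_option autoImplicit false

namespace Literature.NumberTheory.LocalFields.RamifiedQuadraticNorm

open IsLocalRing Literature.NumberTheory.LocalFields.UnramifiedQuadraticNorm

/-! ## §1 Fixed units and norms: membership lemmas -/

section Generic

variable {Λ : Type*} [CommRing Λ] (star : Λ →+* Λ)

/-- **`g ∈ G ↔ ⋆g = g`** for `G = (eqLocus ⋆ id).toSubmonoid.units` (the inverse of a `⋆`-fixed unit is `⋆`-fixed). [cite: Serre1979, Ch. V §2] -/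
theorem mem_units_eqLocus_iff (g : Λˣ) :
    g ∈ (RingHom.eqLocus star (RingHom.id Λ)).toSubmonoid.units ↔ star (g : Λ) = g := by
  rw [Submonoid.mem_units_iff]
  constructor
  · intro h
    exact h.1
  · intro h
    refine ⟨h, ?_⟩
    change star (↑g⁻¹ : Λ) = ↑g⁻¹
    have h1 : star (↑g⁻¹ : Λ) * (g : Λ) = 1 := by
      conv_lhs => rw [← h, ← map_mul, Units.inv_mul, map_one]
    calc star (↑g⁻¹ : Λ) = star (↑g⁻¹ : Λ) * ((g : Λ) * ↑g⁻¹) := by rw [Units.mul_inv, mul_one]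
      _ = ↑g⁻¹ := by rw [← mul_assoc, h1, one_mul]

/-- The value of the norm `N = id·⋆` on a unit: `N(z) = z·⋆z`. [cite: Serre1979, Ch. V §2] -/
theorem coe_norm_apply (z : Λˣ) : (((MonoidHom.id Λˣ * Units.map (star : Λ →* Λ)) z : Λˣ) : Λ) = (z : Λ) * star z := by
  rw [MonoidHom.mul_apply, Units.val_mul, MonoidHom.id_apply, Units.coe_map]; rfl

/-- **`g ∈ W ↔ ∃ z, z·⋆z = g`** for `W = range (id·⋆)` (a `z` with `z·⋆z` a unit is a unit). [cite: Serre1979, Ch. V §2] -/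
theorem mem_range_norm_iff (g : Λˣ) :
    g ∈ (MonoidHom.id Λˣ * Units.map (star : Λ →* Λ)).range ↔ ∃ z : Λ, z * star z = g := by
  constructor
  · rintro ⟨z, hz⟩
    exact ⟨z, by rw [← coe_norm_apply, hz]⟩
  · rintro ⟨z, hz⟩
    have hzu : IsUnit z := isUnit_of_mul_isUnit_left (by rw [hz]; exact g.isUnit)
    refine ⟨hzu.unit, Units.ext ?_⟩
    rw [coe_norm_apply, IsUnit.unit_spec, hz]

/-- A product of norms is a norm: `(z₁⋆z₁)(z₂⋆z₂) = (z₁z₂)⋆(z₁z₂)`. [cite: Serre1979, Ch. V §2] -/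
theorem mul_map_mul_mul_map (z₁ z₂ : Λ) : (z₁ * star z₁) * (z₂ * star z₂) = (z₁ * z₂) * star (z₁ * z₂) := by
  rw [map_mul]; ring

/-- For a `⋆`-fixed `η`: `η·(η·(z⋆z)) = (ηz)·⋆(ηz)` — the square of a fixed element times a norm is a norm. [cite: Serre1979, Ch. V §3 Cor. 2] -/
theorem fixed_mul_fixed_mul_norm {η : Λ} (hη : star η = η) (z : Λ) : η * (η * (z * star z)) = (η * z) * star (η * z) := by
  rw [map_mul, hη]; ring

end Generic

section Prod

variable {A B : Type*} [CommRing A] [CommRing B] (s : A →+* A) (t : B →+* B)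

/-- `⋆ = (s, t)` on a pair. [cite: Serre1979, Ch. V §2] -/
theorem prodMap_apply_mk (a : A) (b : B) : RingHom.prodMap s t (a, b) = (s a, t b) := rfl

/-- **NORMS IN `A × B` ARE COORDINATEWISE**: `g ∈ W ↔ (∃ x, x·s x = g.1) ∧ (∃ y, y·t y = g.2)`. [cite: Serre1979, Ch. V §2] -/
theorem mem_range_norm_prodMap_iff (g : (A × B)ˣ) :
    g ∈ (MonoidHom.id (A × B)ˣ * Units.map (RingHom.prodMap s t : A × B →* A × B)).range ↔
      (∃ x : A, x * s x = (g : A × B).1) ∧ (∃ y : B, y * t y = (g : A × B).2) := by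
  rw [mem_range_norm_iff]
  constructor
  · rintro ⟨⟨x, y⟩, hz⟩
    rw [prodMap_apply_mk, Prod.mk_mul_mk] at hz
    exact ⟨⟨x, congrArg Prod.fst hz⟩, ⟨y, congrArg Prod.snd hz⟩⟩
  · rintro ⟨⟨x, hx⟩, ⟨y, hy⟩⟩
    exact ⟨(x, y), by rw [prodMap_apply_mk, Prod.mk_mul_mk, hx, hy]⟩

/-- **FIXED UNITS IN `A × B` ARE COORDINATEWISE**: `g ∈ G ↔ s g.1 = g.1 ∧ t g.2 = g.2`. [cite: Serre1979, Ch. V §2] -/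
theorem mem_units_eqLocus_prodMap_iff (g : (A × B)ˣ) :
    g ∈ (RingHom.eqLocus (RingHom.prodMap s t) (RingHom.id (A × B))).toSubmonoid.units ↔ s (g : A × B).1 = (g : A × B).1 ∧ t (g : A × B).2 = (g : A × B).2 := by
  rw [mem_units_eqLocus_iff]
  obtain ⟨a, b⟩ := (g : A × B)
  rw [prodMap_apply_mk, Prod.mk.injEq]

/-! ## §2 The subgroup dichotomy: `[H : H ∩ W] = 2` -/

variable [IsLocalRing A]

/-- **THE SUBGROUP DICHOTOMY — `[H : H ∩ W] = 2`.**  `s` a residually trivial involution of the local ring `A` (`𝔪`-adically complete, finite residue field, `2 ∈ Aˣ`), `t` any ring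
endomorphism of `B`, `⋆ = (s, t)` on `Λ = A × B`; `H ≤ G` a subgroup of `⋆`-fixed units such that (a) some `η₀ ∈ H` has FIRST coordinate of NON-square residue and (b) every
`h ∈ H` has a SECOND coordinate which is a `t`-norm `y·t y`.  Then the norms `W = N(Λ^×)` have relative index `2` in `H`: `h ∈ H` is a norm iff its first coordinate has square
residue, and `η₀·h` is a norm otherwise (★ B-p10 `exists_mul_map_eq_or_eq_mul`).  In the (iii) assembly `H = R^{⋆×}`, `η₀ = (η, jη)`.
[cite: Serre1979, Ch. V §3 Prop. 5 and Cor. 2 p. 86] [cite: Hungerford1974, Ch. I Thm. 4.5] -/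
theorem relIndex_range_norm_eq_two_of_snd_norm [IsAdicComplete (maximalIdeal A) A] [Finite (ResidueField A)]
    (hs : ∀ a, s (s a) = a) (hres : ∀ x, s x - x ∈ maximalIdeal A) (h2 : IsUnit (2 : A))
    {H : Subgroup (A × B)ˣ} (hHG : H ≤ (RingHom.eqLocus (RingHom.prodMap s t) (RingHom.id (A × B))).toSubmonoid.units)
    {η₀ : (A × B)ˣ} (hη₀H : η₀ ∈ H) (hη₀ : ¬ IsSquare (residue A (η₀ : A × B).1))
    (hsnd : ∀ h ∈ H, ∃ y : B, y * t y = (h : A × B).2) :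
    (MonoidHom.id (A × B)ˣ * Units.map (RingHom.prodMap s t : A × B →* A × B)).range.relIndex H = 2 := by
  rw [Subgroup.relIndex_eq_two_iff_exists_notMem_and']
  have hη₀fix := (mem_units_eqLocus_prodMap_iff s t η₀).1 (hHG hη₀H)
  refine ⟨η₀, hη₀H, ?_, fun h hh => ?_⟩
  · -- `η₀ ∉ W`: a norm has square residue
    intro hW
    obtain ⟨⟨x, hx⟩, -⟩ := (mem_range_norm_prodMap_iff s t η₀).1 hW
    exact hη₀ (isSquare_residue_of_mul_map_eq s hres hx)
  · have hhfix := (mem_units_eqLocus_prodMap_iff s t h).1 (hHG hh)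
    have hhu : IsUnit (h : A × B).1 := (Prod.isUnit_iff.1 h.isUnit).1
    obtain ⟨y, hy⟩ := hsnd h hh
    obtain ⟨y₀, hy₀⟩ := hsnd η₀ hη₀H
    obtain ⟨x, hx | hx⟩ := exists_mul_map_eq_or_eq_mul s hs hres h2 hη₀fix.1 hη₀ hhu hhfix.1
    · -- `h` itself is a norm
      exact Or.inr ((mem_range_norm_prodMap_iff s t h).2 ⟨⟨x, hx⟩, ⟨y, hy⟩⟩)
    · -- `η₀·h` is a norm: first coordinate `η·(η·x s x) = (ηx)·s(ηx)`, second `(y₀ t y₀)(y t y)`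
      refine Or.inl ((mem_range_norm_prodMap_iff s t (η₀ * h)).2 ⟨⟨(η₀ : A × B).1 * x, ?_⟩, ⟨y₀ * y, ?_⟩⟩)
      · rw [Units.val_mul, Prod.fst_mul, ← hx, fixed_mul_fixed_mul_norm s hη₀fix.1]
      · rw [Units.val_mul, Prod.snd_mul, ← hy₀, ← hy, mul_map_mul_mul_map]

/-- **`[H : H ∩ W] = 2`, TYPE B** (`t` of UNRAMIFIED type: `t b₀ − b₀ ∈ Bˣ` for some `b₀`, `B` local, complete, finite residue field): the second-coordinate clause of
`relIndex_range_norm_eq_two_of_snd_norm` is automatic (★ `UnramifiedQuadraticNorm.exists_mul_map_eq_of_finite_residueField`: every `t`-fixed unit of `B` is a norm).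
[cite: Serre1979, Ch. V §2 Prop. 3 and Corollary; Ch. V §3 Cor. 2] -/
theorem relIndex_range_norm_eq_two_of_unramified [IsAdicComplete (maximalIdeal A) A] [Finite (ResidueField A)]
    [IsLocalRing B] [IsAdicComplete (maximalIdeal B) B] [Finite (ResidueField B)]
    (hs : ∀ a, s (s a) = a) (hres : ∀ x, s x - x ∈ maximalIdeal A) (h2 : IsUnit (2 : A))
    (ht : ∀ b, t (t b) = b) {b₀ : B} (hb₀ : IsUnit (t b₀ - b₀))
    {H : Subgroup (A × B)ˣ} (hHG : H ≤ (RingHom.eqLocus (RingHom.prodMap s t) (RingHom.id (A × B))).toSubmonoid.units)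
    {η₀ : (A × B)ˣ} (hη₀H : η₀ ∈ H) (hη₀ : ¬ IsSquare (residue A (η₀ : A × B).1)) :
    (MonoidHom.id (A × B)ˣ * Units.map (RingHom.prodMap s t : A × B →* A × B)).range.relIndex H = 2 := by
  refine relIndex_range_norm_eq_two_of_snd_norm s t hs hres h2 hHG hη₀H hη₀ fun h hh => ?_
  have hhfix := (mem_units_eqLocus_prodMap_iff s t h).1 (hHG hh)
  exact exists_mul_map_eq_of_finite_residueField t ht hb₀ _ (Prod.isUnit_iff.1 h.isUnit).2 hhfix.2

/-- **`[H : H ∩ W] = 2`, TYPE A** (`t` of RAMIFIED type: residually trivial, `2 ∈ Bˣ`, `B` local, complete, finite residue field): the second-coordinate clause follows from SQUARE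
RESIDUES — if every `h ∈ H` has second coordinate of square residue in `B` then it is a `t`-norm (★ B-p10 `exists_mul_map_eq_of_isSquare_residue`).  In (iii): the second
coordinate of `r ∈ R^⋆` has residue in `𝓀_E ⊂ (𝓀_{O₁})²`. [cite: Serre1979, Ch. V §3 Prop. 5 and Cor. 2 p. 86] -/
theorem relIndex_range_norm_eq_two_of_isSquare_residue [IsAdicComplete (maximalIdeal A) A] [Finite (ResidueField A)]
    [IsLocalRing B] [IsAdicComplete (maximalIdeal B) B]
    (hs : ∀ a, s (s a) = a) (hres : ∀ x, s x - x ∈ maximalIdeal A) (h2 : IsUnit (2 : A))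
    (ht : ∀ b, t (t b) = b) (hrest : ∀ x, t x - x ∈ maximalIdeal B) (h2B : IsUnit (2 : B))
    {H : Subgroup (A × B)ˣ} (hHG : H ≤ (RingHom.eqLocus (RingHom.prodMap s t) (RingHom.id (A × B))).toSubmonoid.units)
    {η₀ : (A × B)ˣ} (hη₀H : η₀ ∈ H) (hη₀ : ¬ IsSquare (residue A (η₀ : A × B).1))
    (hsq : ∀ h ∈ H, IsSquare (residue B (h : A × B).2)) :
    (MonoidHom.id (A × B)ˣ * Units.map (RingHom.prodMap s t : A × B →* A × B)).range.relIndex H = 2 := by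
  refine relIndex_range_norm_eq_two_of_snd_norm s t hs hres h2 hHG hη₀H hη₀ fun h hh => ?_
  have hhfix := (mem_units_eqLocus_prodMap_iff s t h).1 (hHG hh)
  exact exists_mul_map_eq_of_isSquare_residue t ht hrest h2B (Prod.isUnit_iff.1 h.isUnit).2 hhfix.2 (hsq h hh)

/-! ## §3 The full fixed units: `[G : W] = 2` (type B), `[G : W] = 4` (type A) -/

omit [IsLocalRing A] in
/-- A `⋆`-fixed unit of `A × B` built from fixed units of the factors. [cite: Serre1979, Ch. V §2] -/
theorem mk_mem_units_eqLocus_prodMap {a : A} {b : B} (ha : IsUnit a) (hb : IsUnit b) (hsa : s a = a) (htb : t b = b) :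
    (Prod.isUnit_iff.2 ⟨ha, hb⟩ : IsUnit ((a, b) : A × B)).unit ∈ (RingHom.eqLocus (RingHom.prodMap s t) (RingHom.id (A × B))).toSubmonoid.units := by
  rw [mem_units_eqLocus_prodMap_iff, IsUnit.unit_spec]
  exact ⟨hsa, htb⟩

/-- **`[G : W] = 2`, TYPE B**: `s` of ramified type on `A`, `t` of unramified type on `B` (both local, complete, finite residue field, `2 ∈ Aˣ`): the norms `W = N(Λ^×)` have index
`2` in the `⋆`-fixed units `G` of `Λ = A × B` — witness `η₀ = (η, 1)` with `η` ★ B-p10's `s`-fixed non-norm unit.  (`[G : W] = [𝒪_F^× : N 𝒪_E^×]·[𝒪_{K′}^× : N 𝒪_M^×] = 2·1`.)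
[cite: Serre1979, Ch. V §2 Prop. 3; Ch. V §3 Cor. 2 p. 86] -/
theorem relIndex_range_norm_units_eqLocus_eq_two [IsAdicComplete (maximalIdeal A) A] [Finite (ResidueField A)]
    [IsLocalRing B] [IsAdicComplete (maximalIdeal B) B] [Finite (ResidueField B)]
    (hs : ∀ a, s (s a) = a) (hres : ∀ x, s x - x ∈ maximalIdeal A) (h2 : IsUnit (2 : A))
    (ht : ∀ b, t (t b) = b) {b₀ : B} (hb₀ : IsUnit (t b₀ - b₀)) :
    (MonoidHom.id (A × B)ˣ * Units.map (RingHom.prodMap s t : A × B →* A × B)).range.relIndex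
      (RingHom.eqLocus (RingHom.prodMap s t) (RingHom.id (A × B))).toSubmonoid.units = 2 := by
  obtain ⟨η, hηu, hsη, hηsq, -⟩ := exists_fixed_isUnit_not_exists_mul_map_eq s hs hres h2
  have hmem := mk_mem_units_eqLocus_prodMap s t hηu isUnit_one hsη (map_one t)
  exact relIndex_range_norm_eq_two_of_unramified s t hs hres h2 ht hb₀ le_rfl hmem (by rw [IsUnit.unit_spec]; exact hηsq)

/-- **`[G : W] = 4`, TYPE A**: `s`, `t` BOTH of ramified type (`A`, `B` local, complete, finite residue field, `2` a unit in each): the norms have index `4` in the `⋆`-fixed units of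
`A × B` — through the chain `W ≤ W′ ≤ G`, `W′ = G ⊓ {second coordinate a t-norm}`: `[G : W′] = 2` (witness `(1, η_B)`) and `[W′ : W] = 2` (witness `(η_A, 1)`, §2).
(`[G : W] = [𝒪_F^× : N 𝒪_E^×]·[𝒪_{K′}^× : N 𝒪_M^×] = 2·2`, `M ∕ K′` ramified in type A.) [cite: Serre1979, Ch. V §3 Prop. 5 and Cor. 2 p. 86] [cite: Hungerford1974, Ch. I Thm. 4.5] -/
theorem relIndex_range_norm_units_eqLocus_eq_four [IsAdicComplete (maximalIdeal A) A] [Finite (ResidueField A)]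
    [IsLocalRing B] [IsAdicComplete (maximalIdeal B) B] [Finite (ResidueField B)]
    (hs : ∀ a, s (s a) = a) (hres : ∀ x, s x - x ∈ maximalIdeal A) (h2 : IsUnit (2 : A))
    (ht : ∀ b, t (t b) = b) (hrest : ∀ x, t x - x ∈ maximalIdeal B) (h2B : IsUnit (2 : B)) :
    (MonoidHom.id (A × B)ˣ * Units.map (RingHom.prodMap s t : A × B →* A × B)).range.relIndex
      (RingHom.eqLocus (RingHom.prodMap s t) (RingHom.id (A × B))).toSubmonoid.units = 4 := by
  -- names
  set W := (MonoidHom.id (A × B)ˣ * Units.map (RingHom.prodMap s t : A × B →* A × B)).range with hW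
  set G := (RingHom.eqLocus (RingHom.prodMap s t) (RingHom.id (A × B))).toSubmonoid.units with hG
  -- the intermediate subgroup `W′ = G ⊓ {g | g.2 is a t-norm}` (second factor's norms pulled back along `snd`)
  set W' : Subgroup (A × B)ˣ := G ⊓ ((MonoidHom.id Bˣ * Units.map (t : B →* B)).range).comap (Units.map (RingHom.snd A B : A × B →* B)) with hW'
  have hmemW' : ∀ g : (A × B)ˣ, g ∈ W' ↔ g ∈ G ∧ ∃ y : B, y * t y = (g : A × B).2 := fun g => by
    rw [hW', Subgroup.mem_inf, Subgroup.mem_comap, mem_range_norm_iff]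
    rfl
  have hWW' : W ≤ W' := fun g hg => by
    rw [hmemW']
    obtain ⟨⟨x, hx⟩, ⟨y, hy⟩⟩ := (mem_range_norm_prodMap_iff s t g).1 hg
    refine ⟨(mem_units_eqLocus_prodMap_iff s t g).2 ⟨?_, ?_⟩, ⟨y, hy⟩⟩
    · rw [← hx, map_mul, hs, mul_comm]
    · rw [← hy, map_mul, ht, mul_comm]
  have hW'G : W' ≤ G := fun g hg => ((hmemW' g).1 hg).1
  -- `[W′ : W] = 2` by the subgroup dichotomy with witness `(η_A, 1)`
  obtain ⟨ηA, hηAu, hsηA, hηAsq, -⟩ := exists_fixed_isUnit_not_exists_mul_map_eq s hs hres h2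
  have hηA₀ := mk_mem_units_eqLocus_prodMap s t hηAu isUnit_one hsηA (map_one t)
  have hηA₀W' : (Prod.isUnit_iff.2 ⟨hηAu, isUnit_one⟩ : IsUnit ((ηA, (1 : B)) : A × B)).unit ∈ W' := by
    rw [hmemW']
    exact ⟨hηA₀, ⟨1, by rw [map_one, mul_one, IsUnit.unit_spec]⟩⟩
  have h1 : W.relIndex W' = 2 :=
    relIndex_range_norm_eq_two_of_snd_norm s t hs hres h2 hW'G hηA₀W' (by rw [IsUnit.unit_spec]; exact hηAsq) fun h hh => ((hmemW' h).1 hh).2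
  -- `[G : W′] = 2` with witness `(1, η_B)`
  obtain ⟨ηB, hηBu, htηB, hηBsq, hηBn⟩ := exists_fixed_isUnit_not_exists_mul_map_eq t ht hrest h2B
  have hηB₀ := mk_mem_units_eqLocus_prodMap s t isUnit_one hηBu (map_one s) htηB
  have h2' : W'.relIndex G = 2 := by
    rw [Subgroup.relIndex_eq_two_iff_exists_notMem_and']
    refine ⟨_, hηB₀, fun hW'mem => ?_, fun g hg => ?_⟩
    · obtain ⟨-, ⟨y, hy⟩⟩ := (hmemW' _).1 hW'mem
      rw [IsUnit.unit_spec] at hy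
      exact hηBn ⟨y, hy⟩
    · have hgfix := (mem_units_eqLocus_prodMap_iff s t g).1 hg
      have hgu : IsUnit (g : A × B).2 := (Prod.isUnit_iff.1 g.isUnit).2
      obtain ⟨y, hy | hy⟩ := exists_mul_map_eq_or_eq_mul t ht hrest h2B htηB hηBsq hgu hgfix.2
      · exact Or.inr ((hmemW' g).2 ⟨hg, ⟨y, hy⟩⟩)
      · refine Or.inl ((hmemW' _).2 ⟨Subgroup.mul_mem _ hηB₀ hg, ⟨ηB * y, ?_⟩⟩)
        rw [Units.val_mul, Prod.snd_mul, IsUnit.unit_spec, ← hy, fixed_mul_fixed_mul_norm t htηB]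
  rw [← Subgroup.relIndex_mul_relIndex W W' G hWW' hW'G, h1, h2']

end Prod

/-! ## §4 The index identity for the (iii) assembly -/

/-- **`[W : V ∩ W]·[G : W] = [V ⊓ G : V ∩ W]·[G : V ⊓ G]`** for subgroups `V, W, G` of a group with `W ≤ G` (both sides equal `[G : V ∩ W]`; Mathlib `inf_relIndex_right`,
`relIndex_mul_relIndex`).  With `V = R^×`, `W = N(Λ^×)`, `G` the fixed units: `[W : V ∩ W]` — the factor of ★ C2a `relIndex_comap_norm_mul_relIndex_eq_index` — from §2 (`[V⊓G : V∩W] = 2`),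
§3 (`[G : W]`) and (ii-d) (`[G : V ⊓ G]`). [cite: Hungerford1974, Ch. I Thm. 4.5] [cite: Neukirch1999, Ch. I §12] -/
theorem relIndex_mul_relIndex_eq_relIndex_inf_mul {Γ : Type*} [Group Γ] (V W G : Subgroup Γ) (hWG : W ≤ G) :
    V.relIndex W * W.relIndex G = W.relIndex (V ⊓ G) * (V ⊓ G).relIndex G := by
  have hL : V.relIndex W * W.relIndex G = (V ⊓ W).relIndex G := by
    rw [← Subgroup.inf_relIndex_right V W]
    exact Subgroup.relIndex_mul_relIndex (V ⊓ W) W G inf_le_right hWG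
  have hR : W.relIndex (V ⊓ G) * (V ⊓ G).relIndex G = (V ⊓ W).relIndex G := by
    have hWVG : W ⊓ (V ⊓ G) = V ⊓ W :=
      le_antisymm (le_inf (inf_le_right.trans inf_le_left) inf_le_left) (le_inf inf_le_right (le_inf inf_le_left (inf_le_right.trans hWG)))
    rw [← Subgroup.inf_relIndex_right W (V ⊓ G), hWVG]
    exact Subgroup.relIndex_mul_relIndex (V ⊓ W) (V ⊓ G) G (le_inf inf_le_left (inf_le_right.trans hWG)) inf_le_right
  rw [hL, hR]

end Literature.NumberTheory.LocalFields.RamifiedQuadraticNorm
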